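import Mathlib
import Literature.Analysis.SpecialFunctions.OblateSpheroidalCompleteness
import HarnessLib

/-!
# The associated Legendre sectors: for every `m ∈ ℕ` a Hilbert basis of `L²([-1, 1])` of the
# form `(1 - x²)^{m/2} q_k(x)`, `q_k` orthogonal polynomials for the weight `(1 - x²)^m`

Topic `Literature/Analysis/SpecialFunctions` (namespace `Literature.Analysis.SpecialFunctions`),
continuing `LegendreHilbertBasis.lean` / `OblateSpheroidalCompleteness.lean`. In the variable
`x = cos θ`, a function on the sphere with azimuthal dependence `e^{imφ}` is `S(cos θ) e^{imφ}`, and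
smoothness across the poles forces `S = sin^m θ · E(cos θ) = (1 - x²)^{m/2} E(x)`
(`SpheroidalHarmonicEigenfunction.lean`); the spherical harmonics of order `m` are
`(1 - x²)^{m/2} q(x)` with `q` a polynomial (Gegenbauer `C^{(m+1/2)}`, i.e. `d^m P_ℓ/dx^m`). This file
builds, for every `m`, the corresponding complete orthonormal system of `L²([-1,1])` WITHOUT explicit
formulas, by Gram–Schmidt:

* `assocLegWeight m = (1 - X²)^m ∈ ℝ[X]`, the linear functional `polyIntegral p = ∫_{-1}^1 p`, and the
  weighted form `assocLegForm m p q = ∫_{-1}^1 p q (1 - x²)^m` (bilinear, symmetric, **positive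
  definite** `assocLegForm_self_pos`);
* `assocLegPoly m k` — the **monic orthogonal polynomials** for the weight `(1 - x²)^m` (Gram–Schmidt
  on `1, x, x², …`): monic of degree `k` (`monic_assocLegPoly`, `natDegree_assocLegPoly`), pairwise
  orthogonal (`assocLegForm_assocLegPoly_of_ne`), spanning the polynomials of degree `≤ n`
  (`exists_eq_sum_assocLegPoly`) and orthogonal to every polynomial of lower degree
  (`assocLegForm_assocLegPoly_of_natDegree_lt`);
* `assocLegFn m p x = (√(1 - x²))^m p(x)` and its class `assocLegL2 m p ∈ L²([-1,1])`, with
  `⟨assocLegL2 m p, assocLegL2 m q⟩ = assocLegForm m p q` (`inner_assocLegL2`);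
* `assocLegBasis m : HilbertBasis ℕ ℂ L²([-1,1])`, `assocLegBasis m k = c_{m,k} • assocLegL2 m q_k`
  (`assocLegBasis_apply`): orthonormal by construction and **complete** — a vector orthogonal to all
  `(1-x²)^{m/2} q` has `(1-x²)^{m/2} g ⊥` all polynomials, hence `(1-x²)^{m/2} g = 0` by the density of
  polynomials (`span_legendreL2_dense`) and the self-adjointness of the weight multiplication
  (`isSelfAdjoint_legendreMul`), hence `g = 0` a.e. (`assocLeg_dense`).

For `m = 0` the `q_k` are the monic Legendre polynomials. The eigenvalue problem of the order-`m`
spheroidal operator in this basis is the subject of the sequel. Everything is PROVED; no named facts.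

## References

* M. Dafermos, I. Rodnianski, Y. Shlapentokh-Rothman, arXiv:1402.7034 = Ann. of Math. 183 (2016),
  §5.2.1 (the complete orthonormal systems `S_{mℓ}(ν, cos θ) e^{imφ}`; `ν = 0`: spherical
  harmonics). [DafermosRodnianskiShlapentokhrothman2014]
* G. E. Andrews, R. Askey, R. Roy, *Special Functions*, CUP 1999, §6.4 (ultraspherical
  polynomials, orthogonal for the weight `(1 - x²)^{λ - 1/2}`) and Ch. 5, introduction (orthogonal
  polynomials of a positive weight by Gram–Schmidt). [AndrewsAskeyRoy1999]
-/

noncomputable section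

open MeasureTheory Set Filter Topology Polynomial Finset Literature.Analysis.OperatorTheory
open scoped ENNReal InnerProductSpace ComplexConjugate

namespace Literature.Analysis.SpecialFunctions

/-! ### The weight `(1 - X²)^m` and the weighted form -/

/-- The associated Legendre / Gegenbauer weight `(1 - X²)^m`. [folklore] -/
def assocLegWeight (m : ℕ) : ℝ[X] := (1 - X ^ 2) ^ m

/-- `(1 - x²)^m ≥ 0` on `[-1, 1]`. [folklore] -/
theorem assocLegWeight_eval_nonneg (m : ℕ) {x : ℝ} (hx : x ∈ Icc (-1 : ℝ) 1) :
    0 ≤ (assocLegWeight m).eval x := by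
  simp only [assocLegWeight, eval_pow, eval_sub, eval_one, eval_X]
  exact pow_nonneg (by nlinarith [hx.1, hx.2]) m

/-- `(1 - x²)^m > 0` on `(-1, 1)`. [folklore] -/
theorem assocLegWeight_eval_pos (m : ℕ) {x : ℝ} (hx : x ∈ Ioo (-1 : ℝ) 1) :
    0 < (assocLegWeight m).eval x := by
  simp only [assocLegWeight, eval_pow, eval_sub, eval_one, eval_X]
  exact pow_pos (by nlinarith [hx.1, hx.2]) m

/-- The linear functional `p ↦ ∫_{-1}^1 p`. [folklore] -/
def polyIntegral : ℝ[X] →ₗ[ℝ] ℝ where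
  toFun p := ∫ x in (-1 : ℝ)..1, p.eval x
  map_add' p q := by
    simp only [eval_add]
    exact intervalIntegral.integral_add (p.continuous.intervalIntegrable _ _)
      (q.continuous.intervalIntegrable _ _)
  map_smul' c p := by
    simp only [eval_smul, smul_eq_mul, RingHom.id_apply]
    exact intervalIntegral.integral_const_mul _ _

/-- `polyIntegral p = ∫_{-1}^1 p`. [folklore] -/
theorem polyIntegral_apply (p : ℝ[X]) : polyIntegral p = ∫ x in (-1 : ℝ)..1, p.eval x := rfl

/-- **The weighted form** `B_m(p, q) = ∫_{-1}^1 p(x) q(x) (1 - x²)^m dx`. [folklore] -/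
def assocLegForm (m : ℕ) (p q : ℝ[X]) : ℝ := polyIntegral (p * q * assocLegWeight m)

/-- The weighted form as an integral. [folklore] -/
theorem assocLegForm_eq_integral (m : ℕ) (p q : ℝ[X]) :
    assocLegForm m p q = ∫ x in (-1 : ℝ)..1, p.eval x * q.eval x * (assocLegWeight m).eval x := by
  simp only [assocLegForm, polyIntegral_apply, eval_mul]

/-- Symmetry. [folklore] -/
theorem assocLegForm_comm (m : ℕ) (p q : ℝ[X]) : assocLegForm m p q = assocLegForm m q p := by
  rw [assocLegForm, assocLegForm, mul_comm p q]

/-- Additivity in the first slot. [folklore] -/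
theorem assocLegForm_add_left (m : ℕ) (p₁ p₂ q : ℝ[X]) :
    assocLegForm m (p₁ + p₂) q = assocLegForm m p₁ q + assocLegForm m p₂ q := by
  simp only [assocLegForm, add_mul, map_add]

/-- Subtraction in the first slot. [folklore] -/
theorem assocLegForm_sub_left (m : ℕ) (p₁ p₂ q : ℝ[X]) :
    assocLegForm m (p₁ - p₂) q = assocLegForm m p₁ q - assocLegForm m p₂ q := by
  simp only [assocLegForm, sub_mul, map_sub]

/-- Homogeneity in the first slot. [folklore] -/
theorem assocLegForm_C_mul_left (m : ℕ) (c : ℝ) (p q : ℝ[X]) :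
    assocLegForm m (C c * p) q = c * assocLegForm m p q := by
  simp only [assocLegForm]
  rw [mul_assoc, mul_assoc, C_mul', map_smul, smul_eq_mul, ← mul_assoc]

/-- Finite sums in the first slot. [folklore] -/
theorem assocLegForm_sum_left (m : ℕ) {ι : Type*} (s : Finset ι) (p : ι → ℝ[X]) (q : ℝ[X]) :
    assocLegForm m (∑ i ∈ s, p i) q = ∑ i ∈ s, assocLegForm m (p i) q := by
  simp only [assocLegForm, Finset.sum_mul, map_sum]

/-- Homogeneity in the second slot. [folklore] -/
theorem assocLegForm_C_mul_right (m : ℕ) (c : ℝ) (p q : ℝ[X]) :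
    assocLegForm m p (C c * q) = c * assocLegForm m p q := by
  rw [assocLegForm_comm, assocLegForm_C_mul_left, assocLegForm_comm]

/-- **Positive definiteness**: `B_m(p, p) > 0` for `p ≠ 0` (the integrand `p² (1-x²)^m` is
continuous, nonnegative on `[-1,1]`, and positive at a non-root of `p` in `(-1, 1)`). [folklore] -/
theorem assocLegForm_self_pos (m : ℕ) {p : ℝ[X]} (hp : p ≠ 0) : 0 < assocLegForm m p p := by
  rw [assocLegForm_eq_integral]
  -- a point of `(-1, 1)` which is not a root
  obtain ⟨c, hc, hcr⟩ : ∃ c ∈ Ioo (-1 : ℝ) 1, ¬ p.IsRoot c := by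
    have hinf : (Ioo (-1 : ℝ) 1 \ {x | p.IsRoot x}).Infinite :=
      (Ioo_infinite (by norm_num)).sdiff (finite_setOf_isRoot hp)
    obtain ⟨c, hc⟩ := hinf.nonempty
    exact ⟨c, hc.1, hc.2⟩
  have h0 : ∫ x in (-1 : ℝ)..1, (0 : ℝ) = 0 := by simp
  rw [← h0]
  refine intervalIntegral.integral_lt_integral_of_continuousOn_of_le_of_exists_lt (by norm_num)
    continuousOn_const (Continuous.continuousOn (by fun_prop)) (fun x hx ↦ ?_) ⟨c, Ioo_subset_Icc_self hc, ?_⟩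
  · rw [← sq]
    exact mul_nonneg (sq_nonneg _) (assocLegWeight_eval_nonneg m (Ioc_subset_Icc_self hx))
  · have hne : p.eval c ≠ 0 := hcr
    rw [← sq]
    exact mul_pos (by positivity) (assocLegWeight_eval_pos m hc)

/-- `B_m(p, p) ≥ 0`. [folklore] -/
theorem assocLegForm_self_nonneg (m : ℕ) (p : ℝ[X]) : 0 ≤ assocLegForm m p p := by
  by_cases hp : p = 0
  · simp [hp, assocLegForm]
  · exact (assocLegForm_self_pos m hp).le

/-! ### Gram–Schmidt: the monic orthogonal polynomials for the weight `(1 - x²)^m` -/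

/-- **The monic orthogonal polynomials** `q_k = q_k^{(m)}` for the weight `(1 - x²)^m` on `[-1,1]`
(Gram–Schmidt applied to `1, X, X², …`):
`q_k = X^k - Σ_{i<k} (B_m(X^k, q_i) / B_m(q_i, q_i)) q_i`. Up to normalisation these are the
Gegenbauer polynomials `C_k^{(m+1/2)}`. [cite: AndrewsAskeyRoy1999, Ch. 5 (introduction)] -/
def assocLegPoly (m : ℕ) (k : ℕ) : ℝ[X] :=
  X ^ k - ∑ i : Fin k, C (assocLegForm m (X ^ k) (assocLegPoly m i) /
    assocLegForm m (assocLegPoly m i) (assocLegPoly m i)) * assocLegPoly m i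
termination_by k
decreasing_by exact i.isLt

/-- The Gram–Schmidt recursion. [folklore] -/
theorem assocLegPoly_eq (m k : ℕ) :
    assocLegPoly m k = X ^ k - ∑ i : Fin k, C (assocLegForm m (X ^ k) (assocLegPoly m i) /
      assocLegForm m (assocLegPoly m i) (assocLegPoly m i)) * assocLegPoly m i := by
  rw [assocLegPoly]

/-- `q_0 = 1`. [folklore] -/
theorem assocLegPoly_zero (m : ℕ) : assocLegPoly m 0 = 1 := by
  rw [assocLegPoly_eq]
  simp

/-- **`q_k` is monic of degree `k`.** [folklore] -/
theorem monic_assocLegPoly_and_natDegree (m : ℕ) :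
    ∀ k, (assocLegPoly m k).Monic ∧ (assocLegPoly m k).natDegree = k := by
  intro k
  induction k using Nat.strong_induction_on with
  | _ k ih =>
    rw [assocLegPoly_eq]
    have hdeg : (∑ i : Fin k, C (assocLegForm m (X ^ k) (assocLegPoly m i) /
        assocLegForm m (assocLegPoly m i) (assocLegPoly m i)) * assocLegPoly m i).degree < k := by
      refine (degree_sum_le _ _).trans_lt ?_
      refine (Finset.sup_lt_iff (WithBot.bot_lt_coe k)).2 fun i _ ↦ ?_
      calc (C _ * assocLegPoly m i).degree ≤ ((C _ * assocLegPoly m i).natDegree : WithBot ℕ) :=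
            degree_le_natDegree
        _ ≤ ((assocLegPoly m i).natDegree : WithBot ℕ) := by exact_mod_cast natDegree_C_mul_le _ _
        _ = (i : ℕ) := by rw [(ih i i.isLt).2]
        _ < k := by exact_mod_cast i.isLt
    have hmonic : (X ^ k - ∑ i : Fin k, C (assocLegForm m (X ^ k) (assocLegPoly m i) /
        assocLegForm m (assocLegPoly m i) (assocLegPoly m i)) * assocLegPoly m i).Monic :=
      (monic_X_pow k).sub_of_left (by rwa [degree_X_pow])
    refine ⟨hmonic, ?_⟩
    have hd : (X ^ k - ∑ i : Fin k, C (assocLegForm m (X ^ k) (assocLegPoly m i) /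
        assocLegForm m (assocLegPoly m i) (assocLegPoly m i)) * assocLegPoly m i).degree =
        (k : WithBot ℕ) := by
      rw [degree_sub_eq_left_of_degree_lt (by rwa [degree_X_pow]), degree_X_pow]
    exact natDegree_eq_of_degree_eq_some hd

/-- `q_k` is monic. [folklore] -/
theorem monic_assocLegPoly (m k : ℕ) : (assocLegPoly m k).Monic :=
  (monic_assocLegPoly_and_natDegree m k).1

/-- `deg q_k = k`. [folklore] -/
theorem natDegree_assocLegPoly (m k : ℕ) : (assocLegPoly m k).natDegree = k :=
  (monic_assocLegPoly_and_natDegree m k).2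

/-- `q_k ≠ 0`. [folklore] -/
theorem assocLegPoly_ne_zero (m k : ℕ) : assocLegPoly m k ≠ 0 := (monic_assocLegPoly m k).ne_zero

/-- `B_m(q_k, q_k) > 0`. [folklore] -/
theorem assocLegForm_assocLegPoly_self_pos (m k : ℕ) :
    0 < assocLegForm m (assocLegPoly m k) (assocLegPoly m k) :=
  assocLegForm_self_pos m (assocLegPoly_ne_zero m k)

/-- **Orthogonality** (the Gram–Schmidt induction): `B_m(q_k, q_i) = 0` for `i < k`. [folklore] -/
theorem assocLegForm_assocLegPoly_of_lt (m : ℕ) : ∀ k i, i < k →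
    assocLegForm m (assocLegPoly m k) (assocLegPoly m i) = 0 := by
  intro k
  induction k using Nat.strong_induction_on with
  | _ k ih =>
    intro i hik
    -- orthogonality among the `q_j`, `j < k`
    have horth : ∀ j₁ j₂ : ℕ, j₁ < k → j₂ < k → j₁ ≠ j₂ →
        assocLegForm m (assocLegPoly m j₁) (assocLegPoly m j₂) = 0 := by
      intro j₁ j₂ h₁ h₂ hne
      rcases lt_or_gt_of_ne hne with h | h
      · rw [assocLegForm_comm]; exact ih j₂ h₂ j₁ h
      · exact ih j₁ h₁ j₂ h
    rw [assocLegPoly_eq m k, assocLegForm_sub_left, assocLegForm_sum_left]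
    simp_rw [assocLegForm_C_mul_left]
    rw [Finset.sum_eq_single ⟨i, hik⟩]
    · have hpos := assocLegForm_assocLegPoly_self_pos m i
      field_simp
      ring
    · intro j _ hj
      rw [horth j i j.isLt hik (fun h ↦ hj (Fin.ext h)), mul_zero]
    · intro h; exact absurd (Finset.mem_univ _) h

/-- Pairwise orthogonality. [folklore] -/
theorem assocLegForm_assocLegPoly_of_ne (m : ℕ) {k i : ℕ} (h : k ≠ i) :
    assocLegForm m (assocLegPoly m k) (assocLegPoly m i) = 0 := by
  rcases lt_or_gt_of_ne h with h | h
  · rw [assocLegForm_comm]; exact assocLegForm_assocLegPoly_of_lt m i k h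
  · exact assocLegForm_assocLegPoly_of_lt m k i h

/-- **The `q_k`, `k ≤ n`, span the polynomials of degree `≤ n`** (they are monic of exact degree
`k`). [folklore] -/
theorem exists_eq_sum_assocLegPoly (m n : ℕ) : ∀ R : ℝ[X], R.natDegree ≤ n →
    ∃ α : ℕ → ℝ, R = ∑ k ∈ range (n + 1), C (α k) * assocLegPoly m k := by
  induction n with
  | zero =>
    intro R hR
    refine ⟨fun _ ↦ R.coeff 0, ?_⟩
    rw [sum_range_one, assocLegPoly_zero, mul_one]
    exact eq_C_of_natDegree_le_zero hR
  | succ n ih =>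
    intro R hR
    -- subtract the top term
    set R' := R - C (R.coeff (n + 1)) * assocLegPoly m (n + 1) with hR'
    have hR'deg : R'.natDegree ≤ n := by
      rw [natDegree_le_iff_coeff_eq_zero]
      intro N hN
      rw [hR', coeff_sub, coeff_C_mul]
      rcases (show n + 1 ≤ N by omega).eq_or_lt with h | h
      · subst h
        have hl : (assocLegPoly m (n + 1)).coeff (n + 1) = 1 := by
          have := monic_assocLegPoly m (n + 1)
          rw [Monic, leadingCoeff, natDegree_assocLegPoly] at this
          exact this
        rw [hl, mul_one, sub_self]
      · rw [coeff_eq_zero_of_natDegree_lt (hR.trans_lt h), coeff_eq_zero_of_natDegree_lt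
          ((natDegree_assocLegPoly m (n + 1)).le.trans_lt h), mul_zero, sub_zero]
    obtain ⟨α, hα⟩ := ih R' hR'deg
    refine ⟨fun k ↦ if k = n + 1 then R.coeff (n + 1) else α k, ?_⟩
    rw [sum_range_succ]
    beta_reduce
    rw [if_pos rfl]
    have hsum : ∑ k ∈ range (n + 1), C (if k = n + 1 then R.coeff (n + 1) else α k) * assocLegPoly m k =
        ∑ k ∈ range (n + 1), C (α k) * assocLegPoly m k := by
      refine sum_congr rfl fun k hk ↦ ?_
      rw [if_neg (by have := mem_range.1 hk; omega)]
    rw [hsum, ← hα, hR']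
    ring

/-- **`q_k` is orthogonal to every polynomial of degree `< k`.** [folklore] -/
theorem assocLegForm_assocLegPoly_of_natDegree_lt (m : ℕ) {k : ℕ} {R : ℝ[X]}
    (hR : R.natDegree < k) : assocLegForm m (assocLegPoly m k) R = 0 := by
  rcases k with _ | n
  · exact absurd hR (Nat.not_lt_zero _)
  obtain ⟨α, hα⟩ := exists_eq_sum_assocLegPoly m n R (by omega)
  rw [hα, assocLegForm_comm, assocLegForm_sum_left]
  refine sum_eq_zero fun k hk ↦ ?_
  rw [assocLegForm_C_mul_left, assocLegForm_assocLegPoly_of_ne m (by have := mem_range.1 hk; omega),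
    mul_zero]

/-! ### The `L²` classes `(1 - x²)^{m/2} p(x)` -/

/-- The half weight `(√(1 - x²))^m` as a real function on `ℝ` (zero outside `[-1, 1]`). [folklore] -/
def assocLegHalfWeight (m : ℕ) (x : ℝ) : ℝ := Real.sqrt (1 - x ^ 2) ^ m

/-- The half weight is continuous. [folklore] -/
theorem continuous_assocLegHalfWeight (m : ℕ) : Continuous (assocLegHalfWeight m) :=
  ((continuous_const.sub (continuous_id.pow 2)).sqrt).pow m

/-- The half weight is measurable. [folklore] -/
theorem measurable_assocLegHalfWeight (m : ℕ) : Measurable (assocLegHalfWeight m) :=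
  (continuous_assocLegHalfWeight m).measurable

/-- `0 ≤ (√(1-x²))^m ≤ 1`. [folklore] -/
theorem assocLegHalfWeight_nonneg (m : ℕ) (x : ℝ) : 0 ≤ assocLegHalfWeight m x :=
  pow_nonneg (Real.sqrt_nonneg _) m

/-- `|(√(1-x²))^m| ≤ 1`. [folklore] -/
theorem abs_assocLegHalfWeight_le (m : ℕ) (x : ℝ) : |assocLegHalfWeight m x| ≤ 1 := by
  rw [abs_of_nonneg (assocLegHalfWeight_nonneg m x), assocLegHalfWeight]
  refine pow_le_one₀ (Real.sqrt_nonneg _) ?_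
  rw [Real.sqrt_le_one]
  nlinarith [sq_nonneg x]

/-- On `[-1, 1]`: `((√(1-x²))^m)² = (1 - x²)^m`. [folklore] -/
theorem assocLegHalfWeight_sq (m : ℕ) {x : ℝ} (hx : x ∈ Icc (-1 : ℝ) 1) :
    assocLegHalfWeight m x * assocLegHalfWeight m x = (assocLegWeight m).eval x := by
  rw [assocLegHalfWeight, ← mul_pow, ← sq, Real.sq_sqrt (by nlinarith [hx.1, hx.2])]
  simp [assocLegWeight]

/-- On `(-1, 1)` the half weight is positive. [folklore] -/
theorem assocLegHalfWeight_pos (m : ℕ) {x : ℝ} (hx : x ∈ Ioo (-1 : ℝ) 1) :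
    0 < assocLegHalfWeight m x :=
  pow_pos (Real.sqrt_pos.2 (by nlinarith [hx.1, hx.2])) m

/-- The function `x ↦ (√(1-x²))^m p(x)`, complex-valued. [folklore] -/
def assocLegFn (m : ℕ) (p : ℝ[X]) (x : ℝ) : ℂ := ((assocLegHalfWeight m x * p.eval x : ℝ) : ℂ)

/-- Unfolding. [folklore] -/
theorem assocLegFn_apply (m : ℕ) (p : ℝ[X]) (x : ℝ) :
    assocLegFn m p x = ((assocLegHalfWeight m x * p.eval x : ℝ) : ℂ) := rfl

/-- `assocLegFn m p` is continuous. [folklore] -/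
theorem continuous_assocLegFn (m : ℕ) (p : ℝ[X]) : Continuous (assocLegFn m p) :=
  Complex.continuous_ofReal.comp ((continuous_assocLegHalfWeight m).mul p.continuous)

/-- **The `L²([-1,1])` class of `(√(1-x²))^m p(x)`.** [folklore] -/
def assocLegL2 (m : ℕ) (p : ℝ[X]) : Lp ℂ 2 legendreMeasure :=
  (memLp_legendreMeasure_of_continuous (continuous_assocLegFn m p) 2).toLp _

/-- The class is represented by the function. [folklore] -/
theorem coeFn_assocLegL2 (m : ℕ) (p : ℝ[X]) :
    (assocLegL2 m p : ℝ → ℂ) =ᵐ[legendreMeasure] assocLegFn m p :=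
  MemLp.coeFn_toLp _

/-- Additivity of `p ↦ assocLegL2 m p`. [folklore] -/
theorem assocLegL2_add (m : ℕ) (p q : ℝ[X]) :
    assocLegL2 m (p + q) = assocLegL2 m p + assocLegL2 m q := by
  refine Lp.ext ?_
  filter_upwards [coeFn_assocLegL2 m (p + q), coeFn_assocLegL2 m p, coeFn_assocLegL2 m q,
    Lp.coeFn_add (assocLegL2 m p) (assocLegL2 m q)] with x h1 h2 h3 h4
  rw [h4, Pi.add_apply, h1, h2, h3, assocLegFn_apply, assocLegFn_apply, assocLegFn_apply,
    ← Complex.ofReal_add, eval_add, mul_add]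

/-- Homogeneity of `p ↦ assocLegL2 m p`. [folklore] -/
theorem assocLegL2_C_mul (m : ℕ) (c : ℝ) (p : ℝ[X]) :
    assocLegL2 m (C c * p) = (c : ℂ) • assocLegL2 m p := by
  refine Lp.ext ?_
  filter_upwards [coeFn_assocLegL2 m (C c * p), coeFn_assocLegL2 m p,
    Lp.coeFn_smul (c : ℂ) (assocLegL2 m p)] with x h1 h2 h3
  rw [h3, Pi.smul_apply, h1, h2, assocLegFn_apply, assocLegFn_apply, smul_eq_mul,
    ← Complex.ofReal_mul, eval_mul, eval_C]
  congr 1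
  ring

/-- Finite sums. [folklore] -/
theorem assocLegL2_sum (m : ℕ) {ι : Type*} (s : Finset ι) (p : ι → ℝ[X]) :
    assocLegL2 m (∑ i ∈ s, p i) = ∑ i ∈ s, assocLegL2 m (p i) := by
  classical
  induction s using Finset.induction_on with
  | empty =>
    rw [sum_empty, sum_empty]
    refine Lp.ext ?_
    filter_upwards [coeFn_assocLegL2 m 0, Lp.coeFn_zero ℂ 2 legendreMeasure] with x h1 h2
    rw [h1, h2, assocLegFn_apply]
    simp
  | insert a s ha ih => rw [sum_insert ha, sum_insert ha, assocLegL2_add, ih]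

/-- **The inner product of two weighted classes is the weighted form**:
`⟨(1-x²)^{m/2} p, (1-x²)^{m/2} q⟩ = B_m(p, q)`. [folklore] -/
theorem inner_assocLegL2 (m : ℕ) (p q : ℝ[X]) :
    ⟪assocLegL2 m p, assocLegL2 m q⟫_ℂ = (assocLegForm m p q : ℂ) := by
  rw [L2.inner_def, assocLegForm_eq_integral, ← integral_legendreMeasure_eq_intervalIntegral,
    ← integral_complex_ofReal]
  refine integral_congr_ae ?_
  filter_upwards [coeFn_assocLegL2 m p, coeFn_assocLegL2 m q,
    ae_legendreMeasure_of_forall_mem (p := fun x ↦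
      assocLegHalfWeight m x * assocLegHalfWeight m x = (assocLegWeight m).eval x)
      fun x hx ↦ assocLegHalfWeight_sq m hx] with x h1 h2 h3
  rw [RCLike.inner_apply, h1, h2, assocLegFn_apply, assocLegFn_apply, Complex.conj_ofReal,
    ← Complex.ofReal_mul, ← h3]
  congr 1
  ring

/-! ### The Hilbert basis -/

/-- The normalisation constants `c_{m,k} = B_m(q_k, q_k)^{-1/2}`. [folklore] -/
def assocLegNormConst (m k : ℕ) : ℝ := (Real.sqrt (assocLegForm m (assocLegPoly m k) (assocLegPoly m k)))⁻¹

/-- `c_{m,k} > 0`. [folklore] -/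
theorem assocLegNormConst_pos (m k : ℕ) : 0 < assocLegNormConst m k :=
  inv_pos.2 (Real.sqrt_pos.2 (assocLegForm_assocLegPoly_self_pos m k))

/-- `c_{m,k}² B_m(q_k, q_k) = 1`. [folklore] -/
theorem assocLegNormConst_sq_mul (m k : ℕ) :
    assocLegNormConst m k ^ 2 * assocLegForm m (assocLegPoly m k) (assocLegPoly m k) = 1 := by
  have h := assocLegForm_assocLegPoly_self_pos m k
  rw [assocLegNormConst, inv_pow, Real.sq_sqrt h.le]
  exact inv_mul_cancel₀ h.ne'

/-- The normalised weighted classes `e_k = c_{m,k} (1-x²)^{m/2} q_k`. [folklore] -/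
def assocLegVec (m k : ℕ) : Lp ℂ 2 legendreMeasure :=
  (assocLegNormConst m k : ℂ) • assocLegL2 m (assocLegPoly m k)

/-- **Orthonormality of the `e_k`.** [folklore] -/
theorem orthonormal_assocLegVec (m : ℕ) : Orthonormal ℂ (assocLegVec m) := by
  classical
  rw [orthonormal_iff_ite]
  intro k i
  rw [assocLegVec, assocLegVec, inner_smul_left, inner_smul_right, inner_assocLegL2,
    Complex.conj_ofReal]
  split_ifs with h
  · subst h
    rw [← Complex.ofReal_mul, ← Complex.ofReal_mul, ← mul_assoc, ← sq, assocLegNormConst_sq_mul]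
    simp
  · rw [assocLegForm_assocLegPoly_of_ne m h]
    simp

/-- Every weighted polynomial class lies in the span of the `e_k`. [folklore] -/
theorem assocLegL2_mem_span (m : ℕ) (p : ℝ[X]) :
    assocLegL2 m p ∈ Submodule.span ℂ (Set.range (assocLegVec m)) := by
  obtain ⟨α, hα⟩ := exists_eq_sum_assocLegPoly m p.natDegree p le_rfl
  rw [hα, assocLegL2_sum]
  refine Submodule.sum_mem _ fun k _ ↦ ?_
  rw [assocLegL2_C_mul]
  have h : assocLegL2 m (assocLegPoly m k) = ((assocLegNormConst m k)⁻¹ : ℂ) • assocLegVec m k := by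
    rw [assocLegVec, smul_smul, inv_mul_cancel₀ (by exact_mod_cast (assocLegNormConst_pos m k).ne'),
      one_smul]
  rw [h]
  exact Submodule.smul_mem _ _ (Submodule.smul_mem _ _ (Submodule.subset_span (Set.mem_range_self k)))

/-- The Legendre functions are polynomial classes: `P̃_n = polynomialL2 (c_n P_n)`. [folklore] -/
theorem legendreL2_eq_polynomialL2 (n : ℕ) :
    legendreL2 n = polynomialL2 (C (legendreNormConst n) * legendre n) := by
  refine Lp.ext ?_
  filter_upwards [coeFn_legendreL2 n, coeFn_polynomialL2 (C (legendreNormConst n) * legendre n)]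
    with x h1 h2
  rw [h1, h2, legendreFn_apply, eval_mul, eval_C]

/-- The weighted class is the weight multiplication of the polynomial class:
`(1-x²)^{m/2} p = M_{(1-x²)^{m/2}} (polynomialL2 p)`. [folklore] -/
theorem assocLegL2_eq_legendreMul (m : ℕ) (p : ℝ[X]) :
    assocLegL2 m p = legendreMul (measurable_assocLegHalfWeight m) (abs_assocLegHalfWeight_le m)
      (polynomialL2 p) := by
  refine Lp.ext ?_
  filter_upwards [coeFn_assocLegL2 m p, coeFn_polynomialL2 p,
    coeFn_legendreMul (measurable_assocLegHalfWeight m) (abs_assocLegHalfWeight_le m) (polynomialL2 p)]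
    with x h1 h2 h3
  rw [h1, h3, h2, assocLegFn_apply, Complex.ofReal_mul]

/-- **Completeness**: a vector orthogonal to all `(1-x²)^{m/2} q_k` vanishes. Indeed it is then
orthogonal to all `(1-x²)^{m/2} p` (the `q_k` span the polynomials), i.e. `(1-x²)^{m/2} g ⊥ p` for
every polynomial `p` (self-adjointness of the weight multiplication), so `(1-x²)^{m/2} g = 0`
(polynomials are dense), so `g = 0` a.e. (the weight is positive on `(-1, 1)`). [folklore] -/
theorem assocLeg_dense (m : ℕ) :
    ⊤ ≤ (Submodule.span ℂ (Set.range (assocLegVec m))).topologicalClosure := by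
  rw [top_le_iff, Submodule.topologicalClosure_eq_top_iff, Submodule.eq_bot_iff]
  intro g hg
  rw [Submodule.mem_orthogonal] at hg
  set M := legendreMul (measurable_assocLegHalfWeight m) (abs_assocLegHalfWeight_le m) with hM
  have hMsym : ∀ u v : Lp ℂ 2 legendreMeasure, ⟪M u, v⟫_ℂ = ⟪u, M v⟫_ℂ :=
    fun u v ↦ (ContinuousLinearMap.isSelfAdjoint_iff_isSymmetric.1 (isSelfAdjoint_legendreMul _ _)) u v
  -- `M g` is orthogonal to every polynomial class, hence to every `P̃_n`
  have hpoly : ∀ p : ℝ[X], ⟪polynomialL2 p, M g⟫_ℂ = 0 := fun p ↦ by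
    rw [← hMsym, ← assocLegL2_eq_legendreMul]
    exact hg _ (assocLegL2_mem_span m p)
  have hMg : M g ∈ (Submodule.span ℂ (Set.range legendreL2))ᗮ := by
    rw [Submodule.mem_orthogonal']
    intro u hu
    refine Submodule.span_induction (fun v hv ↦ ?_) ?_ (fun a b _ _ ha hb ↦ ?_)
      (fun c v _ hv ↦ ?_) hu
    · obtain ⟨n, rfl⟩ := hv
      rw [inner_eq_zero_symm, legendreL2_eq_polynomialL2]
      exact hpoly _
    · exact inner_zero_right _
    · rw [inner_add_right, ha, hb, add_zero]
    · rw [inner_smul_right, hv, mul_zero]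
  have hbot : (Submodule.span ℂ (Set.range legendreL2))ᗮ = ⊥ :=
    (Submodule.topologicalClosure_eq_top_iff).1 (top_le_iff.1 span_legendreL2_dense)
  rw [hbot, Submodule.mem_bot] at hMg
  -- `M g = 0` means `(1-x²)^{m/2} g = 0` a.e., hence `g = 0` a.e. on `[-1, 1]`
  refine Lp.eq_zero_iff_ae_eq_zero.2 ?_
  have h1 : (M g : ℝ → ℂ) =ᵐ[legendreMeasure] 0 := by
    rw [hMg]
    exact Lp.coeFn_zero ℂ 2 legendreMeasure
  have hpos : ∀ᵐ x ∂legendreMeasure, 0 < assocLegHalfWeight m x := by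
    have hIoo : ∀ᵐ x ∂legendreMeasure, x ∈ Ioo (-1 : ℝ) 1 := by
      rw [show legendreMeasure = volume.restrict (Ioo (-1 : ℝ) 1) from
        Measure.restrict_congr_set Ioo_ae_eq_Icc.symm]
      exact ae_restrict_mem measurableSet_Ioo
    filter_upwards [hIoo] with x hx
    exact assocLegHalfWeight_pos m hx
  filter_upwards [h1, coeFn_legendreMul (measurable_assocLegHalfWeight m) (abs_assocLegHalfWeight_le m) g,
    hpos] with x h0 hmul hwx
  rw [hmul] at h0
  simp only [Pi.zero_apply, mul_eq_zero, Complex.ofReal_eq_zero] at h0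
  exact h0.resolve_left hwx.ne'

/-- **The associated Legendre Hilbert basis of order `m`**: the classes
`e_k = c_{m,k} (1-x²)^{m/2} q_k(x)`, `k ∈ ℕ`, form a Hilbert basis of `L²([-1, 1])`.
[cite: DafermosRodnianskiShlapentokhrothman2014, §5.2.1 (ν = 0: the spherical harmonics of order m)] -/
def assocLegBasis (m : ℕ) : HilbertBasis ℕ ℂ (Lp ℂ 2 legendreMeasure) :=
  HilbertBasis.mk (orthonormal_assocLegVec m) (assocLeg_dense m)

/-- The basis vectors. [folklore] -/
@[simp]
theorem coe_assocLegBasis (m : ℕ) : ⇑(assocLegBasis m) = assocLegVec m :=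
  HilbertBasis.coe_mk _ _

/-- `assocLegBasis m k = c_{m,k} • assocLegL2 m q_k`. [folklore] -/
theorem assocLegBasis_apply (m k : ℕ) :
    assocLegBasis m k = (assocLegNormConst m k : ℂ) • assocLegL2 m (assocLegPoly m k) := by
  rw [coe_assocLegBasis, assocLegVec]

/-- **Coefficients against weighted polynomial classes**:
`⟨e_k, (1-x²)^{m/2} p⟩ = c_{m,k} B_m(q_k, p)`. [folklore] -/
theorem inner_assocLegBasis_assocLegL2 (m k : ℕ) (p : ℝ[X]) :
    ⟪assocLegBasis m k, assocLegL2 m p⟫_ℂ = ((assocLegNormConst m k * assocLegForm m (assocLegPoly m k) p : ℝ) : ℂ) := by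
  rw [assocLegBasis_apply, inner_smul_left, Complex.conj_ofReal, inner_assocLegL2, Complex.ofReal_mul]

end Literature.Analysis.SpecialFunctions
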